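import Summits.QuantumFields.QCD.Theorems.EulerDescentRetypedContinuumComplementHeavyCalibrationTransfer
import HarnessLib

/-!
# Connected two-point functions transform multiplicatively under a change of species renormalisation
(helper of stub `stub_heavyCalibration`, line `vitali-mass-descent`, crux
`Summit.QuantumFields.QCD.Theses.EulerDescent.RetypedContinuumComplement`, item stmt-QuantumFields-16903)

The `n = 2` case of the scheme-transfer identity (`…HeavyCalibrationTransfer`), in the form the heavy
recalibration mechanism consumes.  For two schemes over the same `(reg, m, k)` with `z₁(s,k), z₁(t,k) ≠ 0`
and `λ_s = z₂/z₁ (s,k)`: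

* `connectedTwoPoint_transfer` — WITHOUT any subtraction hypothesis, the connected (truncated)
  two-point functions are shift-blind and scale multiplicatively:
  `⟨Φ₂^s(g) Φ₂^t(h)⟩_conn = λ_s λ_t ⟨Φ₁^s(g) Φ₁^t(h)⟩_conn` (the affine constants cancel in the truncation;
  the junk branch `Z = 0` is covered by `S · (Z/Z) = S`);
* `twoPoint_transfer_of_onePoint_eq_zero` — for a one-point subtracted target the FULL target two-point
  function is `λ_s λ_t` times the reference CONNECTED one;
* `calibrated_twoPoint_transfer` — for a `CalibratedSpeciesFamily 𝒞`:
  `⟨Φ_cal^s(g) Φ_cal^t(h)⟩ = (𝒞.z/z₁)(s) (𝒞.z/z₁)(t) ⟨Φ₁^s(g)Φ₁^t(h)⟩_conn`;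
* the BITING DICTIONARY on the reference pair `(Θf₀, f₀)`: the calibration bites at `(m, s, k)`
  (`⟨Φ_cal^s(Θf₀)Φ_cal^s(f₀)⟩ = 1`) iff the reference connected function `C₁ = ⟨Φ₁^s(Θf₀)Φ₁^s(f₀)⟩_conn`
  is a positive real (`calibrated_bites_iff_ref_pos`), and then `λ_s² C₁ = 1`, i.e.
  `C₁ = (z₁/𝒞.z)²(s,k)` (`ratio_sq_mul_ref_eq_one_of_bite`, `ref_eq_of_bite`) — the lattice form of
  "`λ_k(s)² ⟨Φ_b(Θf₀)Φ_b(f₀)⟩_conn = 1`" in the wave-function renormalisation of Montvay–Münster §1.7.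
Everything is proved; def-free theorem file.
-/

noncomputable section

namespace Summit.QuantumFields.QCD.Cruxes.RetypedContinuumComplement.VitaliMassDescent

open scoped BigOperators SchwartzMap
open MeasureTheory Filter
open Literature.MathematicalPhysics.AQFT Literature.Probability.LatticeModels
  Literature.MathematicalPhysics.QuantumLattice Literature.MathematicalPhysics.QuantumFieldTheory

variable {Nf : ℕ}

/-- The restrictions of a `Fin 2`-string along the subsets `{0}`, `{1}`, `univ`, `∅` are the two
one-point functions, the two-point function and the zero-point function. [folklore] -/
theorem schwinger_fin_two_pieces (sch : QCDScheme Nf) (k : ℕ) (σ : Fin 2 → QCDField Nf)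
    (f : Fin 2 → 𝓢(EuclideanSpace ℝ (Fin 4), ℝ)) :
    qcdLatticeSchwinger sch k ({0} : Finset (Fin 2)).card
        (fun j => σ (({0} : Finset (Fin 2)).orderEmbOfFin rfl j))
        (fun j => f (({0} : Finset (Fin 2)).orderEmbOfFin rfl j)) = sch.onePoint k (σ 0) (f 0) ∧
    qcdLatticeSchwinger sch k ({1} : Finset (Fin 2)).card
        (fun j => σ (({1} : Finset (Fin 2)).orderEmbOfFin rfl j))
        (fun j => f (({1} : Finset (Fin 2)).orderEmbOfFin rfl j)) = sch.onePoint k (σ 1) (f 1) ∧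
    qcdLatticeSchwinger sch k (Finset.univ : Finset (Fin 2)).card
        (fun j => σ ((Finset.univ : Finset (Fin 2)).orderEmbOfFin rfl j))
        (fun j => f ((Finset.univ : Finset (Fin 2)).orderEmbOfFin rfl j)) =
      sch.twoPoint k (σ 0) (σ 1) (f 0) (f 1) ∧
    qcdLatticeSchwinger sch k (∅ : Finset (Fin 2)).card
        (fun j => σ ((∅ : Finset (Fin 2)).orderEmbOfFin rfl j))
        (fun j => f ((∅ : Finset (Fin 2)).orderEmbOfFin rfl j)) = qcdLatticeSchwinger sch k 0 ![] ![] := by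
  refine ⟨?_, ?_, ?_, ?_⟩
  · rw [schwinger_arity_congr _ k _ _ {0} (Finset.card_singleton 0)]
    simp only [Finset.orderEmbOfFin_singleton]
    rfl
  · rw [schwinger_arity_congr _ k _ _ {1} (Finset.card_singleton 1)]
    simp only [Finset.orderEmbOfFin_singleton]
    rfl
  · rw [schwinger_arity_congr _ k _ _ Finset.univ (Finset.card_univ.trans (Fintype.card_fin 2)),
      QCDScheme.twoPoint_eq]
    simp only [orderEmbOfFin_univ_apply]
    congr 1 <;> funext j <;> fin_cases j <;> rfl
  · rw [schwinger_arity_congr _ k _ _ ∅ Finset.card_empty]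
    exact congrArg₂ (qcdLatticeSchwinger _ k 0) (funext fun j => Fin.elim0 j) (funext fun j => Fin.elim0 j)

/-- **CONNECTED TWO-POINT FUNCTIONS TRANSFORM MULTIPLICATIVELY.**  For two schemes over the same
`(reg, m, k)` with `z₁(s,k), z₁(t,k) ≠ 0`,
`⟨Φ₂^s(g)Φ₂^t(h)⟩_conn = (z₂/z₁)(s,k) (z₂/z₁)(t,k) ⟨Φ₁^s(g)Φ₁^t(h)⟩_conn`: the truncated two-point
function does not read the additive counterterms and scales with the multiplicative ones. [cite: GlimmJaffe1987, §6.1] [cite: MontvayMunster1994, §5.1] -/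
theorem connectedTwoPoint_transfer (reg : QCDRegularisation Nf) (m : Fin Nf → ℝ)
    (z₁ shift₁ z₂ shift₂ : QCDField Nf → ℕ → ℝ) (k : ℕ) (s t : QCDField Nf)
    (hs : z₁ s k ≠ 0) (ht : z₁ t k ≠ 0) (g h : 𝓢(EuclideanSpace ℝ (Fin 4), ℝ)) :
    (reg.scheme m z₂ shift₂).connectedTwoPoint k s t g h =
      ((z₂ s k / z₁ s k : ℝ) : ℂ) * ((z₂ t k / z₁ t k : ℝ) : ℂ) *
        (reg.scheme m z₁ shift₁).connectedTwoPoint k s t g h := by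
  have hz : ∀ i : Fin 2, z₁ (![s, t] i) k ≠ 0 := fun i => by
    fin_cases i
    · exact hs
    · exact ht
  obtain ⟨e0, e1, e2, e00⟩ := schwinger_fin_two_pieces (reg.scheme m z₁ shift₁) k ![s, t] ![g, h]
  have hqs : (reg.scheme m z₁ shift₁).onePoint k s g *
      qcdLatticeSchwinger (reg.scheme m z₁ shift₁) k 0 ![] ![] = (reg.scheme m z₁ shift₁).onePoint k s g :=
    qcdLatticeSchwinger_mul_zeroPoint _ k 1 _ _ _ _
  have hqt : (reg.scheme m z₁ shift₁).onePoint k t h *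
      qcdLatticeSchwinger (reg.scheme m z₁ shift₁) k 0 ![] ![] = (reg.scheme m z₁ shift₁).onePoint k t h :=
    qcdLatticeSchwinger_mul_zeroPoint _ k 1 _ _ _ _
  have hqq : qcdLatticeSchwinger (reg.scheme m z₁ shift₁) k 0 ![] ![] *
      qcdLatticeSchwinger (reg.scheme m z₁ shift₁) k 0 ![] ![] =
      qcdLatticeSchwinger (reg.scheme m z₁ shift₁) k 0 ![] ![] :=
    qcdLatticeSchwinger_mul_zeroPoint _ k 0 _ _ _ _
  have h1s := onePoint_transfer reg m z₁ shift₁ z₂ shift₂ k s hs g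
  have h1t := onePoint_transfer reg m z₁ shift₁ z₂ shift₂ k t ht h
  have h2 := qcdLatticeSchwinger_transfer reg m z₁ shift₁ z₂ shift₂ k ![s, t] hz ![g, h]
  rw [sum_finset_fin_two] at h2
  simp only [Matrix.cons_val_zero, Matrix.cons_val_one] at e0 e1 e2 h2
  rw [compl_singleton_fin_two.1, compl_singleton_fin_two.2, e0, e1, e2, e00, Finset.compl_empty,
    Finset.compl_univ, Finset.prod_empty, Finset.prod_empty] at h2
  simp only [Fin.prod_univ_two, Finset.prod_singleton, Matrix.cons_val_zero, Matrix.cons_val_one, one_mul,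
    mul_one, ← QCDScheme.twoPoint_eq] at h2
  simp only [QCDScheme.connectedTwoPoint]
  rw [h2, h1s, h1t]
  set q : ℂ := qcdLatticeSchwinger (reg.scheme m z₁ shift₁) k 0 ![] ![]
  set ls : ℂ := ((z₂ s k / z₁ s k : ℝ) : ℂ)
  set lt : ℂ := ((z₂ t k / z₁ t k : ℝ) : ℂ)
  set cs : ℂ := ((z₂ s k * reg.a k ^ 4 * (shift₁ s k - shift₂ s k) : ℝ) : ℂ) *
    ∑ x ∈ box 4 (reg.L k), ((g (reg.a k • siteToE x) : ℝ) : ℂ)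
  set ct : ℂ := ((z₂ t k * reg.a k ^ 4 * (shift₁ t k - shift₂ t k) : ℝ) : ℂ) *
    ∑ x ∈ box 4 (reg.L k), ((h (reg.a k • siteToE x) : ℝ) : ℂ)
  linear_combination (-(ls * ct)) * hqs + (-(lt * cs)) * hqt + (-(cs * ct)) * hqq

/-- **Two-point transfer for a one-point subtracted target**: if `⟨Φ₂^s(g)⟩ = 0` (or `⟨Φ₂^t(h)⟩ = 0`),
the FULL target two-point function is `λ_s λ_t` times the reference CONNECTED one. [cite: MontvayMunster1994, §5.1] -/
theorem twoPoint_transfer_of_onePoint_eq_zero (reg : QCDRegularisation Nf) (m : Fin Nf → ℝ)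
    (z₁ shift₁ z₂ shift₂ : QCDField Nf → ℕ → ℝ) (k : ℕ) (s t : QCDField Nf)
    (hs : z₁ s k ≠ 0) (ht : z₁ t k ≠ 0) (g h : 𝓢(EuclideanSpace ℝ (Fin 4), ℝ))
    (h₁ : (reg.scheme m z₂ shift₂).onePoint k s g = 0 ∨ (reg.scheme m z₂ shift₂).onePoint k t h = 0) :
    (reg.scheme m z₂ shift₂).twoPoint k s t g h =
      ((z₂ s k / z₁ s k : ℝ) : ℂ) * ((z₂ t k / z₁ t k : ℝ) : ℂ) *
        (reg.scheme m z₁ shift₁).connectedTwoPoint k s t g h := by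
  rw [← QCDScheme.connectedTwoPoint_eq_twoPoint h₁]
  exact connectedTwoPoint_transfer reg m z₁ shift₁ z₂ shift₂ k s t hs ht g h

/-- **Calibrated two-point functions over any reference scheme**: for a `CalibratedSpeciesFamily 𝒞`
(one-point subtracted) and a reference `(z₁, shift₁)` with `z₁(s,k), z₁(t,k) ≠ 0`,
`⟨Φ_cal^s(g)Φ_cal^t(h)⟩ = (𝒞.z/z₁)(s,k) (𝒞.z/z₁)(t,k) ⟨Φ₁^s(g)Φ₁^t(h)⟩_conn`. [cite: MontvayMunster1994, §1.7 (1.251)–(1.253) and §5.1] -/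
theorem calibrated_twoPoint_transfer {reg : QCDRegularisation Nf} (𝒞 : CalibratedSpeciesFamily reg)
    (m : Fin Nf → ℝ) (z₁ shift₁ : QCDField Nf → ℕ → ℝ) (k : ℕ) (s t : QCDField Nf)
    (hs : z₁ s k ≠ 0) (ht : z₁ t k ≠ 0) (g h : 𝓢(EuclideanSpace ℝ (Fin 4), ℝ)) :
    (𝒞.scheme m).twoPoint k s t g h =
      ((𝒞.z m s k / z₁ s k : ℝ) : ℂ) * ((𝒞.z m t k / z₁ t k : ℝ) : ℂ) *
        (reg.scheme m z₁ shift₁).connectedTwoPoint k s t g h := by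
  rw [← 𝒞.connectedTwoPoint_eq]
  exact connectedTwoPoint_transfer reg m z₁ shift₁ (𝒞.z m) (𝒞.shift m) k s t hs ht g h

/-- The squared ratio, as a complex number. [folklore] -/
theorem ofReal_ratio_mul_self {a b : ℝ} :
    ((a / b : ℝ) : ℂ) * ((a / b : ℝ) : ℂ) = (((a / b) ^ 2 : ℝ) : ℂ) := by
  push_cast
  ring

/-- **Calibrated reference two-point function = `λ²` × reference connected function**: on the
calibrating pair `(Θf₀, f₀)` of species `s`,
`⟨Φ_cal^s(Θf₀)Φ_cal^s(f₀)⟩ = (𝒞.z/z₁)²(s,k) · ⟨Φ₁^s(Θf₀)Φ₁^s(f₀)⟩_conn`. [cite: MontvayMunster1994, §1.7 (1.251)–(1.253)] -/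
theorem calibrated_refTwoPoint_eq {reg : QCDRegularisation Nf} (𝒞 : CalibratedSpeciesFamily reg)
    (m : Fin Nf → ℝ) (z₁ shift₁ : QCDField Nf → ℕ → ℝ) (k : ℕ) (s : QCDField Nf) (hs : z₁ s k ≠ 0) :
    (𝒞.scheme m).twoPoint k s s (thetaTest 4 𝒞.f₀) 𝒞.f₀ =
      (((𝒞.z m s k / z₁ s k) ^ 2 : ℝ) : ℂ) *
        (reg.scheme m z₁ shift₁).connectedTwoPoint k s s (thetaTest 4 𝒞.f₀) 𝒞.f₀ := by
  rw [calibrated_twoPoint_transfer 𝒞 m z₁ shift₁ k s s hs hs, ofReal_ratio_mul_self]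

/-- **Biting pins `λ²`**: if the calibration bites at `(m, s, k)`, `⟨Φ_cal^s(Θf₀)Φ_cal^s(f₀)⟩ = 1`,
then `(𝒞.z/z₁)²(s,k) · C₁ = 1` for the reference connected function `C₁`. [cite: MontvayMunster1994, §1.7 (1.251)–(1.253)] -/
theorem ratio_sq_mul_ref_eq_one_of_bite {reg : QCDRegularisation Nf} (𝒞 : CalibratedSpeciesFamily reg)
    (m : Fin Nf → ℝ) (z₁ shift₁ : QCDField Nf → ℕ → ℝ) (k : ℕ) (s : QCDField Nf) (hs : z₁ s k ≠ 0)
    (hbite : (𝒞.scheme m).twoPoint k s s (thetaTest 4 𝒞.f₀) 𝒞.f₀ = 1) :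
    (((𝒞.z m s k / z₁ s k) ^ 2 : ℝ) : ℂ) *
        (reg.scheme m z₁ shift₁).connectedTwoPoint k s s (thetaTest 4 𝒞.f₀) 𝒞.f₀ = 1 := by
  rw [← calibrated_refTwoPoint_eq 𝒞 m z₁ shift₁ k s hs, hbite]

/-- **At a biting step the reference connected function is the positive real `(z₁/𝒞.z)²`**:
`C₁ = (z₁(s,k)/𝒞.z(m,s,k))²`. [cite: MontvayMunster1994, §1.7 (1.251)–(1.253)] -/
theorem ref_eq_of_bite {reg : QCDRegularisation Nf} (𝒞 : CalibratedSpeciesFamily reg)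
    (m : Fin Nf → ℝ) (z₁ shift₁ : QCDField Nf → ℕ → ℝ) (k : ℕ) (s : QCDField Nf) (hs : z₁ s k ≠ 0)
    (hbite : (𝒞.scheme m).twoPoint k s s (thetaTest 4 𝒞.f₀) 𝒞.f₀ = 1) :
    (reg.scheme m z₁ shift₁).connectedTwoPoint k s s (thetaTest 4 𝒞.f₀) 𝒞.f₀ =
      (((z₁ s k / 𝒞.z m s k) ^ 2 : ℝ) : ℂ) := by
  have h := ratio_sq_mul_ref_eq_one_of_bite 𝒞 m z₁ shift₁ k s hs hbite
  have hl : (((𝒞.z m s k / z₁ s k) ^ 2 : ℝ) : ℂ) ≠ 0 :=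
    Complex.ofReal_ne_zero.2 (pow_ne_zero 2 (div_ne_zero (𝒞.z_ne_zero m s k) hs))
  have hl' : (((z₁ s k / 𝒞.z m s k) ^ 2 : ℝ) : ℂ) * (((𝒞.z m s k / z₁ s k) ^ 2 : ℝ) : ℂ) = 1 := by
    rw [← Complex.ofReal_mul, ← mul_pow, div_mul_div_comm, mul_comm (z₁ s k),
      div_self (mul_ne_zero (𝒞.z_ne_zero m s k) hs), one_pow, Complex.ofReal_one]
  calc (reg.scheme m z₁ shift₁).connectedTwoPoint k s s (thetaTest 4 𝒞.f₀) 𝒞.f₀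
      = (((z₁ s k / 𝒞.z m s k) ^ 2 : ℝ) : ℂ) * ((((𝒞.z m s k / z₁ s k) ^ 2 : ℝ) : ℂ) *
          (reg.scheme m z₁ shift₁).connectedTwoPoint k s s (thetaTest 4 𝒞.f₀) 𝒞.f₀) := by
        rw [← mul_assoc, hl', one_mul]
    _ = (((z₁ s k / 𝒞.z m s k) ^ 2 : ℝ) : ℂ) := by rw [h, mul_one]

/-- **THE BITING DICTIONARY.**  The calibration of `𝒞` bites at `(m, s, k)` — the calibrated reference
two-point function equals `1` — iff the reference connected function
`C₁ = ⟨Φ₁^s(Θf₀)Φ₁^s(f₀)⟩_conn` of ANY reference scheme with `z₁(s,k) ≠ 0` is a positive real. [cite: MontvayMunster1994, §1.7 (1.251)–(1.253)] -/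
theorem calibrated_bites_iff_ref_pos {reg : QCDRegularisation Nf} (𝒞 : CalibratedSpeciesFamily reg)
    (m : Fin Nf → ℝ) (z₁ shift₁ : QCDField Nf → ℕ → ℝ) (k : ℕ) (s : QCDField Nf) (hs : z₁ s k ≠ 0) :
    (𝒞.scheme m).twoPoint k s s (thetaTest 4 𝒞.f₀) 𝒞.f₀ = 1 ↔
      0 < ((reg.scheme m z₁ shift₁).connectedTwoPoint k s s (thetaTest 4 𝒞.f₀) 𝒞.f₀).re ∧
        ((reg.scheme m z₁ shift₁).connectedTwoPoint k s s (thetaTest 4 𝒞.f₀) 𝒞.f₀).im = 0 := by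
  constructor
  · intro hbite
    rw [ref_eq_of_bite 𝒞 m z₁ shift₁ k s hs hbite, Complex.ofReal_re, Complex.ofReal_im]
    exact ⟨sq_pos_iff.2 (div_ne_zero hs (𝒞.z_ne_zero m s k)), rfl⟩
  · rintro ⟨hre, him⟩
    have hl : 0 < (𝒞.z m s k / z₁ s k) ^ 2 := sq_pos_iff.2 (div_ne_zero (𝒞.z_ne_zero m s k) hs)
    refine 𝒞.twoPoint_eq_one m s k ?_ ?_
    · rw [calibrated_refTwoPoint_eq 𝒞 m z₁ shift₁ k s hs, Complex.re_ofReal_mul]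
      exact mul_pos hl hre
    · rw [calibrated_refTwoPoint_eq 𝒞 m z₁ shift₁ k s hs, Complex.im_ofReal_mul, him, mul_zero]

/-- **Where the reference connected function is a positive real, the ratio is pinned**:
`(𝒞.z(m,s,k)/z₁(s,k))² = 1 / Re C₁`. [cite: MontvayMunster1994, §1.7 (1.251)–(1.253)] -/
theorem ratio_sq_eq_inv_ref_of_ref_pos {reg : QCDRegularisation Nf} (𝒞 : CalibratedSpeciesFamily reg)
    (m : Fin Nf → ℝ) (z₁ shift₁ : QCDField Nf → ℕ → ℝ) (k : ℕ) (s : QCDField Nf) (hs : z₁ s k ≠ 0)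
    (hre : 0 < ((reg.scheme m z₁ shift₁).connectedTwoPoint k s s (thetaTest 4 𝒞.f₀) 𝒞.f₀).re)
    (him : ((reg.scheme m z₁ shift₁).connectedTwoPoint k s s (thetaTest 4 𝒞.f₀) 𝒞.f₀).im = 0) :
    (𝒞.z m s k / z₁ s k) ^ 2 =
      (((reg.scheme m z₁ shift₁).connectedTwoPoint k s s (thetaTest 4 𝒞.f₀) 𝒞.f₀).re)⁻¹ := by
  have hbite := (calibrated_bites_iff_ref_pos 𝒞 m z₁ shift₁ k s hs).2 ⟨hre, him⟩
  have h := congrArg Complex.re (ratio_sq_mul_ref_eq_one_of_bite 𝒞 m z₁ shift₁ k s hs hbite)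
  rw [Complex.re_ofReal_mul, Complex.one_re] at h
  exact eq_inv_of_mul_eq_one_left h

end Summit.QuantumFields.QCD.Cruxes.RetypedContinuumComplement.VitaliMassDescent

end
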